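import Literature.Analysis.Matrix.CoerciveCombesThomas

/-!
# NE7K1LinSchurLine — row NE7 (node U5), candidate route HOM, path H1L, cell K1-lin(s): the INTERPOLATED-SCHUR
# PROPAGATOR LINE `G(s) = [(1−s)P₀ + s·(A₁ − B·D⁻¹·C)]⁻¹` has EXPONENTIAL OFF-DIAGONAL DECAY with constants
# UNIFORM IN `s ∈ [0,1]` — abstract matrix core (Combes–Thomas on the √s-extended finite-range operator)

Lineage `b2b-balaban-t4-ne7-p2` (CRUX PROVER NE7 #2), generation 63; the ABSTRACT CORE behind the `YM-SURGE-PLAN.md` v1 row X-A7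
checkpoint (companion card `HOME/t4/b2b-balaban-t4-ne7-p2/g63/K1LIN-LINE.md`; filed under the FREEZE (0) protocol line
«INTERFACE REQUEST NE7: NE7K1LinSchurLine.lineOp_inv_decay» of HOME/INBOX.md).  HONEST FRAMING (page 1): FIXED
FINITE T⁴, rung (B)+1, CONDITIONAL on BetaPertH and the nine spine estimates (0/9 proved); NOT infinite volume, NOT a mass
gap, NOT the Clay problem; NE7 NOT PRINTED ∕ NOT PROVED.  Everything below is [folklore] linear algebra over an ABSTRACT
finite index set; no Bałaban object is typed, nothing printed is asserted, no cite tag is a hypothesis, no `sorry`.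

THE OBJECT (ROUTES-NE7 §L1 l.30 «K1-lin(s) PROPAGATORS OF THE LINE»; lens-1 supply v1.1 row 1.4; PRICING-NE7 v14 §78).
On path H1L the step-`j` fluctuation propagators of the interpolated main action are
`G_j(s) = [(1−s)·G_j^{A,−1} + s·G_j^{B,Schur,−1}]⁻¹`, `s ∈ [0,1]`: `P₀ := G_j^{A,−1}` is run A's (finite-range, coercive)
fluctuation operator and `P₁ := G_j^{B,Schur,−1} = A₁ − B·D⁻¹·C` is run B's fluctuation operator SCHUR-COMPLEMENTED over
run B's one extra fine layer (`H₁ = [[A₁, B],[C, D]]` finite-range and coercive on coarse ⊕ fine; `D` = the fine block).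
The CLAIM of the cell is a (1.6)–(1.7)-type walk expansion ∕ decay for `G_j(s)` with constants INDEPENDENT of `s`; the
located worry (ROUTES-NE7 ▶v3 (γ), tripwire (t13)) is that `P₁` is NOT finite-range (a Schur complement has an exponential
tail), so [Balaban1983RegularityDecay] §2's finite-range "obvious fact" does not apply to `P(s) = (1−s)P₀ + sP₁` as it stands.

THE DEVICE OF THIS FILE (not found in ROUTES-NE7 ∕ PRICING-NE7 ∕ the lens supplies; [folklore]): UN-COMPLEMENT WITH A `√s`
WEIGHT.  The extended operator on coarse ⊕ fine
  `𝒫(s) := [[(1−s)P₀ + sA₁, √s·B],[√s·C, D]]`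
is FINITE-RANGE for every `s` (its blocks are), its Schur complement over the fine block is EXACTLY
`(1−s)P₀ + sA₁ − (√s B)D⁻¹(√s C) = P(s)` (`schur_extOp`), so `G(s) = P(s)⁻¹` is the coarse–coarse block of `𝒫(s)⁻¹`
(`inv_extOp_inl_inl`), and its quadratic form is `(1−s)·⟨a, P₀a⟩ + ⟨(√s·a, φ), H₁(√s·a, φ)⟩` (`form_extOp`), hence
`𝒫(s)` is `min(m₀, m₁)`-ACCRETIVE for ALL `s ∈ [0,1]` when `P₀` is `m₀`- and `H₁` is `m₁`-accretive (`accretive_extOp`) —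
no sign relation BETWEEN `P₀` and `P₁` is used (admission fact (S): none needed).  The tree's Combes–Thomas bound
`Literature.Analysis.Matrix.accretive_combes_thomas` then localises `𝒫(s)⁻¹`, and with it `G(s)`, with `s`-FREE constants:

* **`lineOp_inv_decay`** — for every `s ∈ [0,1]`: `P(s)` is invertible and `‖G(s)(x,y)‖ ≤ (2∕m)·e^{−θ·dist(x,y)}`,
  `m = min(m₀,m₁)`, for every `θ ≥ 0` with `h(e^θ − 1) ≤ m∕2`, where `h` bounds the off-diagonal absolute row∕column sums
  of the `s`-free ENVELOPE `[[|P₀|+|A₁|, |B|],[|C|, |D|]]` and `dist` is any ℕ-valued pseudo-metric on coarse ⊕ fine for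
  which the envelope has range one (`M`-cube adjacency in the application).  Every constant on the right is `s`-free.
* `lineOp_inv_sub_inv` — the difference identity `G(s) − G(t) = (t − s)·G(s)(P₁ − P₀)G(t)` (the `d∕ds` letter of K2∕K3′,
  difference-quotient form), so `s ↦ G(s)` is Lipschitz entrywise with the `s`-free bound of `lineOp_inv_decay` twice.

WHAT THIS DOES NOT DO.  It does not type `P₀`, `H₁` for Bałaban's actions (their finite range, coercivity constants
`m₀` = [Balaban1983RegularityDecay] (1.8)-type `γ₀`, `m₁` = run B's one-step joint Hessian positivity WITH the step-`j`
averaging term on the coarse component, and entry bounds are the cell's PRINTED-TYPE inputs, to be supplied by name under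
the typing licence of row X-A7).  Combes–Thomas is a ONE-SCALE bound (rate `θ ≍ m∕h` = gap ∕ bandwidth, the right order
only on the current unit lattice, as in Bałaban's inductive step); the MULTI-SCALE factor `O(M^{−1∕2})^{|ω|}e^{−δ₀d(ω)}` of
(1.7) and the Hölder ∕ derivative norms of [Balaban1985BackgroundPropagators] (3.42)–(3.47) come from
[Balaban1983RegularityDecay] §2–§3 ∕ tree `B4RandomWalk213.walk_decay_bound` applied VERBATIM to the finite-range `𝒫(s)`
(exact locality and background-localised entries hold on coarse ⊕ fine — the point of the device: an APPLICATION of the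
printed template to one more finite-range operator, not a re-run with an exponential-tail twist), not re-derived here;
complex `s` is not treated (the `√s` weight is real; `d∕ds` along the real segment is what H1L consumes).  NOT NE7 (spine
0/9 unchanged), NOT summit progress.
HONEST DEPENDENCY: continuum YM on T⁴ ⇐ BetaPertH ∧ nine spine estimates (0/9 proved); BetaPertH ⇐ (D1) ∧ (D4) ∧ CAP+tail;
G-an2-4 gates asym, D1 and NE2/3/4.
-/

noncomputable section

open Finset Matrix
open scoped Matrix ComplexConjugate

namespace Summit.QuantumFields.BalabanUV.T4Continuum.NE7K1LinSchurLine

variable {ιc ιf : Type*}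

/-! ### §1 The line, the `√s`-extended operator, the envelope -/

section Line

variable [Fintype ιf] [DecidableEq ιf]

/-- The Schur-complemented endpoint `P₁ = A₁ − B·D⁻¹·C` (run B's fluctuation operator seen on run A's lattice). [folklore] -/
def schurOp (A₁ : Matrix ιc ιc ℂ) (B : Matrix ιc ιf ℂ) (C : Matrix ιf ιc ℂ) (D : Matrix ιf ιf ℂ) : Matrix ιc ιc ℂ :=
  A₁ - B * D⁻¹ * C

/-- The interpolated line `P(s) = (1−s)·P₀ + s·(A₁ − B·D⁻¹·C)` (harmonic interpolation of the two propagators = linear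
interpolation of the two fluctuation operators). [folklore] -/
def lineOp (P₀ A₁ : Matrix ιc ιc ℂ) (B : Matrix ιc ιf ℂ) (C : Matrix ιf ιc ℂ) (D : Matrix ιf ιf ℂ) (s : ℝ) :
    Matrix ιc ιc ℂ :=
  (1 - (s : ℂ)) • P₀ + (s : ℂ) • schurOp A₁ B C D

end Line

/-- The `√s`-EXTENDED operator on coarse ⊕ fine: `𝒫(s) = [[(1−s)P₀ + sA₁, √s·B],[√s·C, D]]` — finite-range whenever the
blocks are, for every `s`. [folklore] -/
def extOp (P₀ A₁ : Matrix ιc ιc ℂ) (B : Matrix ιc ιf ℂ) (C : Matrix ιf ιc ℂ) (D : Matrix ιf ιf ℂ) (s : ℝ) :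
    Matrix (ιc ⊕ ιf) (ιc ⊕ ιf) ℂ :=
  fromBlocks ((1 - (s : ℂ)) • P₀ + (s : ℂ) • A₁) ((Real.sqrt s : ℂ) • B) ((Real.sqrt s : ℂ) • C) D

/-- Run B's full one-step Hessian `H₁ = [[A₁, B],[C, D]]` on coarse ⊕ fine (the `s = 1` extended operator). [folklore] -/
def hessB (A₁ : Matrix ιc ιc ℂ) (B : Matrix ιc ιf ℂ) (C : Matrix ιf ιc ℂ) (D : Matrix ιf ιf ℂ) :
    Matrix (ιc ⊕ ιf) (ιc ⊕ ιf) ℂ :=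
  fromBlocks A₁ B C D

/-- The `s`-free ENVELOPE `[[|P₀|+|A₁|, |B|],[|C|, |D|]]` dominating the entries of `𝒫(s)` for `s ∈ [0,1]`. [folklore] -/
def envelope (P₀ A₁ : Matrix ιc ιc ℂ) (B : Matrix ιc ιf ℂ) (C : Matrix ιf ιc ℂ) (D : Matrix ιf ιf ℂ) :
    Matrix (ιc ⊕ ιf) (ιc ⊕ ιf) ℝ :=
  fromBlocks (fun i j => ‖P₀ i j‖ + ‖A₁ i j‖) (fun i j => ‖B i j‖) (fun i j => ‖C i j‖) (fun i j => ‖D i j‖)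

/-- The rescaled test vector `(√s·a, φ)` of the form identity `form_extOp`. [folklore] -/
def uvec (s : ℝ) (w : ιc ⊕ ιf → ℂ) : ιc ⊕ ιf → ℂ :=
  Sum.elim ((Real.sqrt s : ℂ) • (w ∘ Sum.inl)) (w ∘ Sum.inr)

variable (P₀ A₁ : Matrix ιc ιc ℂ) (B : Matrix ιc ιf ℂ) (C : Matrix ιf ιc ℂ) (D : Matrix ιf ιf ℂ)

/-- `√s·√s = s` in `ℂ` for `0 ≤ s`. [folklore] -/
theorem sqrt_mul_sqrt_coe {s : ℝ} (hs : 0 ≤ s) : (Real.sqrt s : ℂ) * (Real.sqrt s : ℂ) = (s : ℂ) := by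
  rw [← Complex.ofReal_mul, Real.mul_self_sqrt hs]

section SchurId

variable [Fintype ιf] [DecidableEq ιf]

/-- **The Schur complement of `𝒫(s)` over the fine block IS the line**: `((1−s)P₀ + sA₁) − (√s B)·D⁻¹·(√s C) = P(s)`
(`0 ≤ s`). [folklore] -/
theorem schur_extOp {s : ℝ} (hs : 0 ≤ s) :
    ((1 - (s : ℂ)) • P₀ + (s : ℂ) • A₁) - ((Real.sqrt s : ℂ) • B) * D⁻¹ * ((Real.sqrt s : ℂ) • C) =
      lineOp P₀ A₁ B C D s := by
  simp only [lineOp, schurOp, Matrix.smul_mul, Matrix.mul_smul, smul_smul, sqrt_mul_sqrt_coe hs, smul_sub]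
  abel

end SchurId

/-- The entries of `𝒫(s)` are dominated by the `s`-free envelope for `s ∈ [0,1]`. [folklore] -/
theorem norm_extOp_le_envelope {s : ℝ} (hs0 : 0 ≤ s) (hs1 : s ≤ 1) (i j : ιc ⊕ ιf) :
    ‖extOp P₀ A₁ B C D s i j‖ ≤ envelope P₀ A₁ B C D i j := by
  have hsq1 : Real.sqrt s ≤ 1 := Real.sqrt_le_one.mpr hs1 |>.trans_eq' rfl
  have hsq0 : 0 ≤ Real.sqrt s := Real.sqrt_nonneg s
  have hcs : ‖(Real.sqrt s : ℂ)‖ ≤ 1 := by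
    rw [Complex.norm_real, Real.norm_eq_abs, abs_of_nonneg hsq0]; exact hsq1
  have h1s : ‖(1 - (s : ℂ))‖ ≤ 1 := by
    rw [show (1 - (s : ℂ)) = ((1 - s : ℝ) : ℂ) by push_cast; ring, Complex.norm_real, Real.norm_eq_abs,
      abs_of_nonneg (by linarith)]
    linarith
  have hss : ‖(s : ℂ)‖ ≤ 1 := by
    rw [Complex.norm_real, Real.norm_eq_abs, abs_of_nonneg hs0]; exact hs1
  rcases i with i | i <;> rcases j with j | j
  · simp only [extOp, envelope, fromBlocks_apply₁₁, Matrix.add_apply, Matrix.smul_apply, smul_eq_mul]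
    calc ‖(1 - (s : ℂ)) * P₀ i j + (s : ℂ) * A₁ i j‖ ≤ ‖(1 - (s : ℂ)) * P₀ i j‖ + ‖(s : ℂ) * A₁ i j‖ := norm_add_le _ _
      _ ≤ 1 * ‖P₀ i j‖ + 1 * ‖A₁ i j‖ := by
          rw [norm_mul, norm_mul]
          exact add_le_add (mul_le_mul_of_nonneg_right h1s (norm_nonneg _))
            (mul_le_mul_of_nonneg_right hss (norm_nonneg _))
      _ = ‖P₀ i j‖ + ‖A₁ i j‖ := by ring
  · simp only [extOp, envelope, fromBlocks_apply₁₂, Matrix.smul_apply, smul_eq_mul, norm_mul]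
    exact (mul_le_mul_of_nonneg_right hcs (norm_nonneg _)).trans_eq (one_mul _)
  · simp only [extOp, envelope, fromBlocks_apply₂₁, Matrix.smul_apply, smul_eq_mul, norm_mul]
    exact (mul_le_mul_of_nonneg_right hcs (norm_nonneg _)).trans_eq (one_mul _)
  · simp only [extOp, envelope, fromBlocks_apply₂₂]
    exact le_rfl

/-! ### §2 The quadratic form of `𝒫(s)` and its UNIFORM accretivity on `[0,1]` -/

section Form

variable [Fintype ιc] [Fintype ιf]

/-- **FORM IDENTITY**: `⟨w, 𝒫(s)w⟩ = (1−s)·⟨a, P₀a⟩ + ⟨(√s·a, φ), H₁(√s·a, φ)⟩` for `w = (a, φ)`, `0 ≤ s` (because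
`√s·√s = s`: the coarse–coarse block `(1−s)P₀ + sA₁` splits as `(1−s)P₀` plus the `A₁`-corner of `H₁` at the rescaled
vector). [folklore] -/
theorem form_extOp {s : ℝ} (hs : 0 ≤ s) (w : ιc ⊕ ιf → ℂ) :
    (∑ i, star (w i) * (extOp P₀ A₁ B C D s *ᵥ w) i) =
      (1 - (s : ℂ)) * (∑ c, star (w (Sum.inl c)) * (P₀ *ᵥ (w ∘ Sum.inl)) c) +
        ∑ i, star (uvec s w i) * (hessB A₁ B C D *ᵥ uvec s w) i := by
  have hss : (Real.sqrt s : ℂ) * (Real.sqrt s : ℂ) = (s : ℂ) := sqrt_mul_sqrt_coe hs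
  simp only [extOp, hessB, uvec, fromBlocks_mulVec, Fintype.sum_sum_type, Sum.elim_inl, Sum.elim_inr,
    Sum.elim_comp_inl, Sum.elim_comp_inr, add_mulVec, smul_mulVec, mulVec_smul, Pi.add_apply,
    Pi.smul_apply, smul_eq_mul, Function.comp_apply, Complex.star_def, map_mul, Complex.conj_ofReal]
  rw [Finset.mul_sum, ← add_assoc]
  congr 1
  rw [← Finset.sum_add_distrib]
  refine Finset.sum_congr rfl fun c _ => ?_
  linear_combination
    (-((starRingEnd ℂ) (w (Sum.inl c)) * (A₁ *ᵥ (w ∘ Sum.inl)) c)) * hss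

/-- **UNIFORM ACCRETIVITY OF THE EXTENDED OPERATOR**: if `P₀` is `m₀`-accretive and run B's Hessian `H₁` is
`m₁`-accretive (`0 < m₀, m₁`), then `𝒫(s)` is `min(m₀,m₁)`-accretive for EVERY `s ∈ [0,1]` — no sign relation between
`P₀` and the Schur endpoint is used. [folklore] -/
theorem accretive_extOp {m₀ m₁ : ℝ}
    (hP₀ : ∀ a : ιc → ℂ, m₀ * ∑ c, ‖a c‖ ^ 2 ≤ (∑ c, star (a c) * (P₀ *ᵥ a) c).re)
    (hH₁ : ∀ u : ιc ⊕ ιf → ℂ, m₁ * ∑ i, ‖u i‖ ^ 2 ≤ (∑ i, star (u i) * (hessB A₁ B C D *ᵥ u) i).re)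
    {s : ℝ} (hs0 : 0 ≤ s) (hs1 : s ≤ 1) (w : ιc ⊕ ιf → ℂ) :
    min m₀ m₁ * ∑ i, ‖w i‖ ^ 2 ≤ (∑ i, star (w i) * (extOp P₀ A₁ B C D s *ᵥ w) i).re := by
  have hmin0 : min m₀ m₁ ≤ m₀ := min_le_left _ _
  have hmin1 : min m₀ m₁ ≤ m₁ := min_le_right _ _
  have h0 := hP₀ (w ∘ Sum.inl)
  have h1 := hH₁ (uvec s w)
  have hSa : 0 ≤ ∑ c, ‖(w ∘ Sum.inl) c‖ ^ 2 := Finset.sum_nonneg fun _ _ => by positivity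
  have hSf : 0 ≤ ∑ f, ‖(w ∘ Sum.inr) f‖ ^ 2 := Finset.sum_nonneg fun _ _ => by positivity
  have hns : ‖(Real.sqrt s : ℂ)‖ ^ 2 = s := by
    rw [Complex.norm_real, Real.norm_eq_abs, abs_of_nonneg (Real.sqrt_nonneg s), Real.sq_sqrt hs0]
  have hu : ∑ i, ‖uvec s w i‖ ^ 2 = s * ∑ c, ‖(w ∘ Sum.inl) c‖ ^ 2 + ∑ f, ‖(w ∘ Sum.inr) f‖ ^ 2 := by
    simp only [uvec, Fintype.sum_sum_type, Sum.elim_inl, Sum.elim_inr, Pi.smul_apply, smul_eq_mul, norm_mul,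
      mul_pow, hns, Finset.mul_sum]
  have hw : ∑ i, ‖w i‖ ^ 2 = ∑ c, ‖(w ∘ Sum.inl) c‖ ^ 2 + ∑ f, ‖(w ∘ Sum.inr) f‖ ^ 2 :=
    Fintype.sum_sum_type _
  have hre : ((1 - (s : ℂ)) * ∑ c, star (w (Sum.inl c)) * (P₀ *ᵥ (w ∘ Sum.inl)) c).re =
      (1 - s) * (∑ c, star ((w ∘ Sum.inl) c) * (P₀ *ᵥ (w ∘ Sum.inl)) c).re := by
    rw [show (1 - (s : ℂ)) = ((1 - s : ℝ) : ℂ) by push_cast; ring, Complex.re_ofReal_mul]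
    rfl
  rw [form_extOp P₀ A₁ B C D hs0 w, Complex.add_re, hre, hw]
  rw [hu] at h1
  have h0' : (1 - s) * (m₀ * ∑ c, ‖(w ∘ Sum.inl) c‖ ^ 2) ≤
      (1 - s) * (∑ c, star ((w ∘ Sum.inl) c) * (P₀ *ᵥ (w ∘ Sum.inl)) c).re :=
    mul_le_mul_of_nonneg_left h0 (by linarith)
  nlinarith [mul_le_mul_of_nonneg_right hmin0 hSa, mul_le_mul_of_nonneg_right hmin1 hSa,
    mul_le_mul_of_nonneg_right hmin1 hSf, mul_nonneg hs0 hSa]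

/-- Accretivity with a positive constant forces `IsUnit det` (injectivity of `mulVec`). [folklore] -/
theorem isUnit_det_of_accretive {ι : Type*} [Fintype ι] [DecidableEq ι] (A : Matrix ι ι ℂ) {m : ℝ} (hm : 0 < m)
    (hacc : ∀ v : ι → ℂ, m * ∑ i, ‖v i‖ ^ 2 ≤ (∑ i, star (v i) * (A *ᵥ v) i).re) : IsUnit A.det := by
  rw [isUnit_iff_ne_zero, Ne, ← Matrix.exists_mulVec_eq_zero_iff]
  rintro ⟨x, hx, hAx⟩
  obtain ⟨j₀, hj₀⟩ := Function.ne_iff.mp hx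
  have h2 : ‖x j₀‖ ^ 2 ≤ ∑ i, ‖x i‖ ^ 2 :=
    Finset.single_le_sum (f := fun i => ‖x i‖ ^ 2) (fun i _ => by positivity) (Finset.mem_univ j₀)
  have h3 : 0 < ‖x j₀‖ ^ 2 := by positivity
  have h4 : (∑ i, star (x i) * (A *ᵥ x) i).re = 0 := by simp [hAx]
  have h5 := hacc x
  rw [h4] at h5
  have h6 : 0 < m * ∑ i, ‖x i‖ ^ 2 := mul_pos hm (h3.trans_le h2)
  linarith

/-- The fine block `D` of an `m₁`-accretive `H₁` is invertible (test `H₁` on `(0, φ)`). [folklore] -/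
theorem isUnit_det_fine [DecidableEq ιf] {m₁ : ℝ} (hm₁ : 0 < m₁)
    (hH₁ : ∀ u : ιc ⊕ ιf → ℂ, m₁ * ∑ i, ‖u i‖ ^ 2 ≤ (∑ i, star (u i) * (hessB A₁ B C D *ᵥ u) i).re) :
    IsUnit D.det := by
  refine isUnit_det_of_accretive D hm₁ fun φ => ?_
  have h := hH₁ (Sum.elim 0 φ)
  simpa only [hessB, fromBlocks_mulVec, Fintype.sum_sum_type, Sum.elim_inl, Sum.elim_inr, Sum.elim_comp_inl,
    Sum.elim_comp_inr, Pi.zero_apply, norm_zero, ne_eq, OfNat.ofNat_ne_zero, not_false_eq_true, zero_pow,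
    Finset.sum_const_zero, zero_add, star_zero, zero_mul, mulVec_zero, Pi.add_apply] using h

end Form

/-! ### §3 Range and row sums from the envelope; the block inverse; the MAIN THEOREM; the `d∕ds` letter -/

section Main

variable [Fintype ιc] [Fintype ιf] [DecidableEq ιc] [DecidableEq ιf]

omit [Fintype ιc] [Fintype ιf] [DecidableEq ιc] [DecidableEq ιf] in
/-- `𝒫(s)` has range one wherever the `s`-free envelope has (`s ∈ [0,1]`). [folklore] -/
theorem range_extOp (dist : ιc ⊕ ιf → ιc ⊕ ιf → ℕ)
    (hrange : ∀ i j, envelope P₀ A₁ B C D i j ≠ 0 → dist i j ≤ 1) {s : ℝ} (hs0 : 0 ≤ s) (hs1 : s ≤ 1) :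
    ∀ i j, extOp P₀ A₁ B C D s i j ≠ 0 → dist i j ≤ 1 := fun i j hij =>
  hrange i j fun h0 => hij (norm_eq_zero.mp
    (le_antisymm ((norm_extOp_le_envelope P₀ A₁ B C D hs0 hs1 i j).trans_eq h0) (norm_nonneg _)))

omit [DecidableEq ιc] [DecidableEq ιf] in
/-- Off-diagonal absolute row sums of `𝒫(s)` are at most those of the envelope (`s ∈ [0,1]`). [folklore] -/
theorem rowSum_extOp (dist : ιc ⊕ ιf → ιc ⊕ ιf → ℕ) {h : ℝ}
    (hrow : ∀ i, ∑ j ∈ univ.filter (fun j => dist i j ≠ 0), envelope P₀ A₁ B C D i j ≤ h)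
    {s : ℝ} (hs0 : 0 ≤ s) (hs1 : s ≤ 1) :
    ∀ i, ∑ j ∈ univ.filter (fun j => dist i j ≠ 0), ‖extOp P₀ A₁ B C D s i j‖ ≤ h := fun i =>
  (Finset.sum_le_sum fun j _ => norm_extOp_le_envelope P₀ A₁ B C D hs0 hs1 i j).trans (hrow i)

omit [DecidableEq ιc] [DecidableEq ιf] in
/-- Off-diagonal absolute column sums of `𝒫(s)` are at most those of the envelope (`s ∈ [0,1]`). [folklore] -/
theorem colSum_extOp (dist : ιc ⊕ ιf → ιc ⊕ ιf → ℕ) {h : ℝ}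
    (hcol : ∀ j, ∑ i ∈ univ.filter (fun i => dist i j ≠ 0), envelope P₀ A₁ B C D i j ≤ h)
    {s : ℝ} (hs0 : 0 ≤ s) (hs1 : s ≤ 1) :
    ∀ j, ∑ i ∈ univ.filter (fun i => dist i j ≠ 0), ‖extOp P₀ A₁ B C D s i j‖ ≤ h := fun j =>
  (Finset.sum_le_sum fun i _ => norm_extOp_le_envelope P₀ A₁ B C D hs0 hs1 i j).trans (hcol j)

/-- Invertibility passes from `𝒫(s)` to its Schur complement `P(s)` (fine block invertible). [folklore] -/
theorem isUnit_det_lineOp_of_extOp {s : ℝ} (hs : 0 ≤ s) (hD : IsUnit D.det)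
    (hE : IsUnit (extOp P₀ A₁ B C D s).det) : IsUnit (lineOp P₀ A₁ B C D s).det := by
  letI := invertibleOfIsUnitDet D hD
  have h1 : IsUnit (extOp P₀ A₁ B C D s) := (Matrix.isUnit_iff_isUnit_det _).mpr hE
  rw [extOp, isUnit_fromBlocks_iff_of_invertible₂₂, invOf_eq_nonsing_inv, schur_extOp P₀ A₁ B C D hs] at h1
  exact (Matrix.isUnit_iff_isUnit_det _).mp h1

/-- **BLOCK INVERSE** (Banachiewicz, bottom-right pivot; Mathlib `Matrix.invOf_fromBlocks₂₂_eq`): the coarse–coarse block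
of `𝒫(s)⁻¹` IS `G(s) = P(s)⁻¹`. [folklore] -/
theorem inv_extOp_inl_inl {s : ℝ} (hs : 0 ≤ s) (hD : IsUnit D.det) (hS : IsUnit (lineOp P₀ A₁ B C D s).det)
    (x y : ιc) : (extOp P₀ A₁ B C D s)⁻¹ (Sum.inl x) (Sum.inl y) = (lineOp P₀ A₁ B C D s)⁻¹ x y := by
  letI := invertibleOfIsUnitDet D hD
  have hS' : IsUnit (((1 - (s : ℂ)) • P₀ + (s : ℂ) • A₁) -
      ((Real.sqrt s : ℂ) • B) * ⅟D * ((Real.sqrt s : ℂ) • C)).det := by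
    rwa [invOf_eq_nonsing_inv, schur_extOp P₀ A₁ B C D hs]
  letI := invertibleOfIsUnitDet _ hS'
  letI := fromBlocks₂₂Invertible ((1 - (s : ℂ)) • P₀ + (s : ℂ) • A₁) ((Real.sqrt s : ℂ) • B)
    ((Real.sqrt s : ℂ) • C) D
  rw [extOp, ← invOf_eq_nonsing_inv (fromBlocks _ _ _ _), invOf_fromBlocks₂₂_eq, fromBlocks_apply₁₁,
    invOf_eq_nonsing_inv, invOf_eq_nonsing_inv, schur_extOp P₀ A₁ B C D hs]

/-- **K1-lin(s), ABSTRACT CORE — UNIFORM-IN-`s` EXPONENTIAL DECAY OF THE INTERPOLATED-SCHUR PROPAGATOR.**  Let `dist` be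
an ℕ-valued pseudo-metric on coarse ⊕ fine for which the `s`-free envelope `[[|P₀|+|A₁|, |B|],[|C|, |D|]]` has range one
and off-diagonal absolute row∕column sums `≤ h`; let `P₀` be `m₀`-accretive and `H₁ = [[A₁,B],[C,D]]` be `m₁`-accretive
(`0 < m₀, m₁`), and let `θ ≥ 0` satisfy `h(e^θ − 1) ≤ min(m₀,m₁)∕2`.  Then for EVERY `s ∈ [0,1]` the line
`P(s) = (1−s)P₀ + s(A₁ − BD⁻¹C)` is invertible and `‖P(s)⁻¹(x,y)‖ ≤ (2∕min(m₀,m₁))·e^{−θ·dist(x,y)}` — every constant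
on the right independent of `s`.  Proof: `accretive_combes_thomas` (tree) on the finite-range, uniformly accretive
`√s`-extension `𝒫(s)`, then the block inverse. [folklore] -/
theorem lineOp_inv_decay (dist : ιc ⊕ ιf → ιc ⊕ ιf → ℕ) (hd0 : ∀ i, dist i i = 0)
    (hds : ∀ i j, dist i j = dist j i) (hdt : ∀ i j k, dist i k ≤ dist i j + dist j k)
    (hrange : ∀ i j, envelope P₀ A₁ B C D i j ≠ 0 → dist i j ≤ 1) (h : ℝ)
    (hrow : ∀ i, ∑ j ∈ univ.filter (fun j => dist i j ≠ 0), envelope P₀ A₁ B C D i j ≤ h)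
    (hcol : ∀ j, ∑ i ∈ univ.filter (fun i => dist i j ≠ 0), envelope P₀ A₁ B C D i j ≤ h)
    {m₀ m₁ : ℝ} (hm₀ : 0 < m₀) (hm₁ : 0 < m₁)
    (hP₀ : ∀ a : ιc → ℂ, m₀ * ∑ c, ‖a c‖ ^ 2 ≤ (∑ c, star (a c) * (P₀ *ᵥ a) c).re)
    (hH₁ : ∀ u : ιc ⊕ ιf → ℂ, m₁ * ∑ i, ‖u i‖ ^ 2 ≤ (∑ i, star (u i) * (hessB A₁ B C D *ᵥ u) i).re)
    (θ : ℝ) (hθ : 0 ≤ θ) (hη : h * (Real.exp θ - 1) ≤ min m₀ m₁ / 2)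
    {s : ℝ} (hs0 : 0 ≤ s) (hs1 : s ≤ 1) :
    IsUnit (lineOp P₀ A₁ B C D s).det ∧
      ∀ x y : ιc, ‖(lineOp P₀ A₁ B C D s)⁻¹ x y‖ ≤
        2 / min m₀ m₁ * Real.exp (-(θ * dist (Sum.inl x) (Sum.inl y))) := by
  have hm : 0 < min m₀ m₁ := lt_min hm₀ hm₁
  obtain ⟨hdetE, hdec⟩ := Literature.Analysis.Matrix.accretive_combes_thomas dist hd0 hds hdt
    (extOp P₀ A₁ B C D s) (range_extOp P₀ A₁ B C D dist hrange hs0 hs1) h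
    (rowSum_extOp P₀ A₁ B C D dist hrow hs0 hs1) (colSum_extOp P₀ A₁ B C D dist hcol hs0 hs1)
    (min m₀ m₁) θ hm hθ (accretive_extOp P₀ A₁ B C D hP₀ hH₁ hs0 hs1) hη
  have hD : IsUnit D.det := isUnit_det_fine A₁ B C D hm₁ hH₁
  have hL : IsUnit (lineOp P₀ A₁ B C D s).det := isUnit_det_lineOp_of_extOp P₀ A₁ B C D hs0 hD hdetE
  refine ⟨hL, fun x y => ?_⟩
  rw [← inv_extOp_inl_inl P₀ A₁ B C D hs0 hD hL x y]
  exact hdec _ _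

omit [Fintype ιc] [DecidableEq ιc] in
/-- The line is affine: `P(t) − P(s) = (t − s)·(P₁ − P₀)`. [folklore] -/
theorem lineOp_sub (s t : ℝ) :
    lineOp P₀ A₁ B C D t - lineOp P₀ A₁ B C D s = ((t : ℂ) - s) • (schurOp A₁ B C D - P₀) := by
  simp only [lineOp, smul_sub, sub_smul]
  abel

/-- **THE `d∕ds` LETTER (difference-quotient form)**: `G(s) − G(t) = (t − s)·G(s)(P₁ − P₀)G(t)` whenever both ends are
invertible — with `lineOp_inv_decay` twice, `s ↦ G(s)` is entrywise Lipschitz on `[0,1]` with an `s`-free constant (what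
K2∕K3′ consume along the line). [folklore] -/
theorem lineOp_inv_sub_inv {s t : ℝ} (hs : IsUnit (lineOp P₀ A₁ B C D s).det)
    (ht : IsUnit (lineOp P₀ A₁ B C D t).det) :
    (lineOp P₀ A₁ B C D s)⁻¹ - (lineOp P₀ A₁ B C D t)⁻¹ =
      ((t : ℂ) - s) • ((lineOp P₀ A₁ B C D s)⁻¹ * (schurOp A₁ B C D - P₀) * (lineOp P₀ A₁ B C D t)⁻¹) := by
  have key : (lineOp P₀ A₁ B C D s)⁻¹ * (lineOp P₀ A₁ B C D t - lineOp P₀ A₁ B C D s) *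
      (lineOp P₀ A₁ B C D t)⁻¹ = (lineOp P₀ A₁ B C D s)⁻¹ - (lineOp P₀ A₁ B C D t)⁻¹ := by
    rw [Matrix.mul_sub, Matrix.sub_mul, Matrix.mul_assoc _ (lineOp P₀ A₁ B C D t), mul_nonsing_inv _ ht,
      Matrix.mul_one, nonsing_inv_mul _ hs, Matrix.one_mul]
  rw [← key, lineOp_sub, Matrix.mul_smul, Matrix.smul_mul]

end Main

end Summit.QuantumFields.BalabanUV.T4Continuum.NE7K1LinSchurLine
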